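import Literature.MathematicalPhysics.QuantumFieldTheory.Balaban1983to89.B9Thm311LaplaceAkPositiveDiagonal
import Literature.MathematicalPhysics.QuantumFieldTheory.Balaban1983to89.B7Eq43AveragedSmallnessLevelFree

/-!
# `Balaban1983to89.B9Thm311SmallFieldCoercivityTowerTwoWindows` — T. Bałaban, *Propagators for lattice gauge theories in a background field*, Commun. Math.
# Phys. **99** (1985) 389–434 [Balaban1985BackgroundPropagators] Thm 3.11 p. 416, Thm 3.4 p. 400, (3.35)–(3.37) p. 396, (3.15)–(3.16) p. 393, (3.25)–(3.26) pp. 394–395;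
# [Balaban1985Averaging] Prop. 2 (52)–(54) p. 26: **THE `k`-LEVEL THM 3.11 CHAIN ON PRINT's DIAGONAL FROM THE TWO WINDOWS OF (3.35) — BONDS `αη` AND
# PLAQUETTES `αη²` — WITH THE LEVEL-PROFILE WINDOW STRUCK**: the row owner's `B9Thm311SmallFieldCoercivityTowerClosed.exists_strong_coercive_tower_diagonal_closed`
# (g85 INTENT-8) and `B9Thm311LaplaceAkPositiveDiagonal.exists_coercive_laplaceAk_diagonal_closed ∕ exists_norm_G1k_le_diagonal_closed ∕
# exists_laplaceAk_pos_diagonal_closed` (g85 INTENT-9) RE-ISSUED with the binders `εU`, `0 ≤ εU j`, `‖Ū^j(b) − 1‖ ≤ εU j`, `εU j ≤ αr^j` and the profile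
# ratio `r` GONE — inhabited at `r = 1∕L` by `B7Eq43AveragedSmallnessLevelFree.exists_profile_of_windows_eta` (LENGTH + AREA, level-free) from the bond
# window, the plaquette window and print's class (52) (`U` valued in an averaging-closed subgroup `S` of the unit ball)

statement-level skeleton of published theorems with citation tags; proofs where landed; nothing here is a claim about the Yang–Mills mass gap

CITATION HEADER (lean-in-tree rule).  Audit cell `pub-balaban`, sub-cell `t4`, BINDER row NE9; filed by NE9 formalisation-swarm leaf prover 03
(`b2b-balaban-t4-ne9-formalise-leaf-03`, gen 65), INTENT I-ne9leaf03-g65-2 — the owner's «window derivation» (g85 `TOWER-R-PROGRAMME.md` §3 (a) ∕ §5; g86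
ONLINE «their derivation = the gauge step, leaves 03∕05») in its derivable part.  Sources READ in the held text `paper:balaban1985-cmp99-background-propagators`
(journal page = PDF page + 388): pp. 393, 396, 400, 416.  Objects BY NAME: the owner's `laplaceAk`, `laplaceALatticeK … (QkW …)`, `RofUk`, `G1LatticeK`,
`towerP`, `UlevOf`, E162's data binders; nothing re-declared, 0 `def`.

THE PRINT (verbatim).  p. 416, Thm 3.11: *«Under the assumptions of the Theorems 3.1–3.10 (i.e. for M sufficiently large and α₀ sufficiently small) the
operators Δ′_a, G′, (Q′G′²Q′*)⁻¹, Δ_a, G are positive definite.»*; p. 396 (3.35): *«… U^u = e^{iηA} … |A| < O(1)Mα₀(L^jη)⁻¹, |∇^η_U A| < O(1)Mα₀(L^jη)⁻² on □»*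
— TWO displays (bond variables `O(αη)`, plaquette variables `O(αη²)`); the smallness of the AVERAGED configurations `Ū^j` ((3.37), [Balaban1985Averaging]
(53)–(54)) is a consequence, not a third hypothesis.

WHAT IS PROVED (sorry-free; proof lane — 0 `def`; [folklore] binder plumbing over two landed files).  With `α₀` the minimum of the owner's threshold over
`1 + 512(d+1)(d+4)` and the two class thresholds `1∕(6C₀)`, `c₂′∕4`, and `U : Bond(T_{L^{n+1}m}) → S` (`S ≤ U1` averaging-closed — e.g. the unitary group
of a C⋆-algebra, `B7Prop2Explicit.avgClosed_unitaryUnits`), `0 ≤ α ≤ α₀`, `‖U(b) − 1‖ ≤ αη`, `‖U(∂p) − 1‖ ≤ αη²`, E162's per-level data, `hRS`: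
* §1 `windows_feed` (private) — the owner's four struck binders inhabited at `α₁`, `r = 1∕L`.
* §2 **`exists_strong_coercive_tower_diagonal_twoWindows`** — `∃ α₀ γ′ > 0` BEFORE every binder: `γ′·(‖D(1)x‖² + ‖D*(1)x‖² + ‖x‖²) ≤ re⟨x, (D*D + DR_kD* + aQ_k†Q_k)x⟩`
  (the principal operator, strong; INTENT-8 re-issued).
* §3 **`exists_coercive_laplaceAk_diagonal_twoWindows`** (`γ₁‖x‖² ≤ re⟨x, Δ^{(n+1)}_a(U)x⟩`, the full operator with curvature),
  **`exists_norm_G1k_le_diagonal_twoWindows`** (`‖G_k(U)y‖ ≤ γ₁⁻¹‖y‖` — Thm 3.4's `L²` clause, any positivity witness),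
  **`exists_laplaceAk_pos_diagonal_twoWindows`** (Thm 3.11 «Δ_a positive definite»; the displayed `hpos` of `G1k ∕ H1k ∕ frakGk` discharged) — INTENT-9 re-issued.
WHAT STAYS DISPLAYED.  The bond window and the plaquette window (print's (3.35), read on the torus), E162's per-level averaging data (ARGUMENTS of `QkW`;
a theorem from (52): `B9Eq315QTowerRegularityProfile`), `hRS` (unitary backgrounds), the point `ηL^{n+1} = 1`, `c₀(L^{n+1})^d = c₁`.  NOT HERE: the bond
window from the plaquette window (GLOBAL on the torus it is false — non-contractible holonomies, `B7Eq45TorusGaugeOrbit`; print's (3.35) is PER CUBE: the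
IMS ∕ localisation road), decay (Thms 3.12 ∕ 3.13), infinite volume.
HONEST SCOPE.  [folklore]; «NE9 ⇐ the named binders»; NE9 NOT PRINTED ∕ NOT PROVED; NOT summit progress (cell pub-balaban: row NE9 WALLED ON A MODEL;
spine PROVED 0/9; rung (B)+1 finite T⁴ — NOT infinite volume, NOT mass gap, NOT Clay; HONEST DEPENDENCY: continuum YM on T⁴ ⇐ BetaPertH ∧ nine spine
estimates (0/9 proved); BetaPertH ⇐ (D1) ∧ (D4) ∧ CAP+tail; G-an2-4 gates asym, D1 and NE2/3/4).  NEW file; modifies nothing.  Net new unproved facts: 0.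
-/

noncomputable section

open scoped InnerProductSpace ComplexConjugate BigOperators

namespace Literature.MathematicalPhysics.QuantumFieldTheory.Balaban1983to89.B9Thm311SmallFieldCoercivityTowerTwoWindows

open B4Sect5Torus (TSite)
open B9SectCLatticeCarrier (Bond)
open B11Eq103H1Complex (SiteL2K BondL2K covDivL2K laplaceALatticeK G1LatticeK)
open B9Eq310HessianOperator (adTransportW principalOpK covCurlL2K)
open B9Eq310DeltaPrime (plaqHolU)
open B9Eq315QTorus (perCfg cornerSite)
open B9Eq315QTower (towerP UlevOf)
open B9Eq326OperatorTower (QkW RofUk laplaceAk)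
open B7Prop1Explicit (U1 Wcx boxVec)
open B7Prop2Explicit (C0 c2' AvgClosed C0_pos c2'_pos)
open B7Eq43AveragedSmallnessLevelFree (exists_profile_of_windows_eta)
open B9Thm311SmallFieldCoercivityTowerClosed (exists_strong_coercive_tower_diagonal_closed)
open B9Thm311LaplaceAkPositiveDiagonal (exists_coercive_laplaceAk_diagonal_closed exists_norm_G1k_le_diagonal_closed exists_laplaceAk_pos_diagonal_closed)

variable {d : ℕ} (L : ℕ) [NeZero L] (hL : 1 ≤ L) (hL2 : 2 ≤ L) {𝔸 : Type*} [NormedRing 𝔸] [NormedAlgebra ℂ 𝔸] [CompleteSpace 𝔸] [NormOneClass 𝔸]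

/-! ## §1 The struck binders, inhabited -/

section Feed

include hL2 in
/-- From the two windows at `α ≤ α₀` and the class thresholds on `2α₀`: `U ∈ U1`, the bond window at the owner's `α₁ ≥ (1 + 512(d+1)(d+4))α₀`, and a
level profile `εU` with `εU j ≤ α₁(1∕L)^j` for `j < n+1` (`exists_profile_of_windows_eta` at the class constant `2α₀ > α`). [folklore] -/
private theorem windows_feed (m : Fin d → ℕ) [∀ i, NeZero (m i)] (n : ℕ) {S : Subgroup 𝔸ˣ} (hS : AvgClosed d L S)
    {U : Bond d (towerP L m (n + 1)) → 𝔸ˣ} (hU : ∀ b, U b ∈ S) {α₁ α₀ α η : ℝ} (hα₀ : 0 < α₀) (hCw : α₀ * (1 + 512 * (d + 1) * (d + 4)) ≤ α₁)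
    (h3 : C0 d * (2 * α₀) ≤ 1 / 3) (h2 : 2 * (2 * α₀) ≤ c2' d L) (hηL : η * (L : ℝ) ^ (n + 1) = 1) (hα0 : 0 ≤ α) (hαle : α ≤ α₀)
    (hUη : ∀ b, ‖(U b : 𝔸) - 1‖ ≤ α * η) (hpl : ∀ p : B9SectCLatticeCarrier.Plaq d (towerP L m (n + 1)), ‖(plaqHolU U p : 𝔸) - 1‖ ≤ α * η ^ 2) :
    (∀ b, U b ∈ U1 𝔸) ∧ (∀ b, ‖(U b : 𝔸) - 1‖ ≤ α₁ * η) ∧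
      ∃ εU : ℕ → ℝ, (∀ j, 0 ≤ εU j) ∧ (∀ (j : ℕ) (b : Bond d (towerP L m (j + 1))), ‖(UlevOf L m (n + 1) U j b : 𝔸) - 1‖ ≤ εU j) ∧
        ∀ j < n + 1, εU j ≤ α₁ * (1 / (L : ℝ)) ^ j := by
  have hL0 : (0 : ℝ) < L := by exact_mod_cast lt_of_lt_of_le (by norm_num) hL2
  have hL1 : (1 : ℝ) ≤ L := by exact_mod_cast le_trans (by norm_num) hL2
  have hN : (0 : ℝ) < (L : ℝ) ^ (n + 1) := pow_pos hL0 _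
  have hη : η = ((L : ℝ) ^ (n + 1))⁻¹ := (inv_eq_of_mul_eq_one_left hηL).symm
  have hη0 : 0 < η := by rw [hη]; positivity
  have hαlt : α < 2 * α₀ := by linarith
  have hd : (0 : ℝ) ≤ 512 * (d + 1) * (d + 4) := by positivity
  have hα₁ : α ≤ α₁ := by nlinarith
  obtain ⟨εU, hεU, hUε, hεg⟩ := exists_profile_of_windows_eta L m n hL2 hS hU (α₀ := 2 * α₀) (by positivity) h3 h2 hηL hα0 hαlt hUη hpl
  refine ⟨fun b => hS.le_U1 (hU b), fun b => (hUη b).trans (mul_le_mul_of_nonneg_right hα₁ hη0.le), εU, hεU, hUε, fun j hj => (hεg j hj).trans ?_⟩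
  have hB0 : 0 ≤ α + 256 * (d + 1) * (d + 4) * (2 * α₀) := by positivity
  have hB : α + 256 * (d + 1) * (d + 4) * (2 * α₀) ≤ α₁ := by nlinarith
  have h1 : (α + 256 * (d + 1) * (d + 4) * (2 * α₀)) / L ≤ α₁ := (div_le_self hB0 hL1).trans hB
  exact mul_le_mul_of_nonneg_right h1 (by positivity)

omit [NeZero L] in
include hL2 in
/-- The three thresholds of the two-window theorems below one name: `T = min(α₁∕(1 + 512(d+1)(d+4)), 1∕(6C₀), c₂′∕4)`. [folklore] -/
private theorem thresholds {α₁ : ℝ} (hα₁ : 0 < α₁) :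
    ∃ T : ℝ, 0 < T ∧ T * (1 + 512 * (d + 1) * (d + 4)) ≤ α₁ ∧ C0 d * (2 * T) ≤ 1 / 3 ∧ 2 * (2 * T) ≤ c2' d L := by
  have hC0 := C0_pos d
  have hc2 := c2'_pos d L (le_trans (by norm_num) hL2)
  refine ⟨min (α₁ / (1 + 512 * (d + 1) * (d + 4))) (min (1 / (6 * C0 d)) (c2' d L / 4)),
    lt_min (by positivity) (lt_min (by positivity) (by positivity)), ?_, ?_, ?_⟩
  · rw [← le_div_iff₀ (by positivity)]; exact min_le_left _ _
  · have hA3 : min (α₁ / (1 + 512 * (d + 1) * (d + 4))) (min (1 / (6 * C0 d)) (c2' d L / 4)) ≤ 1 / (6 * C0 d) :=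
      (min_le_right _ _).trans (min_le_left _ _)
    have h := mul_le_mul_of_nonneg_left hA3 hC0.le
    rw [mul_one_div, show C0 d / (6 * C0 d) = 1 / 6 by field_simp] at h
    linarith
  · have hA2 : min (α₁ / (1 + 512 * (d + 1) * (d + 4))) (min (1 / (6 * C0 d)) (c2' d L / 4)) ≤ c2' d L / 4 :=
      (min_le_right _ _).trans (min_le_right _ _)
    linarith

end Feed

/-! ## §2 The principal operator, strong (INTENT-8 re-issued) -/

section Principal

variable {W : Type*} [NormedAddCommGroup W] [InnerProductSpace ℂ W] [FiniteDimensional ℂ W] (φ : W ≃ₗ[ℂ] 𝔸)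
  {Mφ Mφ' : ℝ} (hMφ : 0 ≤ Mφ) (hMφ' : 0 ≤ Mφ') (hφ : ∀ w, ‖φ w‖ ≤ Mφ * ‖w‖) (hφ' : ∀ X, ‖φ.symm X‖ ≤ Mφ' * ‖X‖) {a : ℝ} (ha : 0 < a)

include hL2 hMφ hMφ' hφ hφ' ha

/-- **[B9] THM 3.11's SECOND HALF AT `k = n+1` LEVELS ON PRINT's DIAGONAL, STRONG, FROM THE TWO WINDOWS OF (3.35)**: there are `α₀, γ′ > 0` (closed in
`(d, a, L, M_φ, M_φ′)`; `γ′ = γ(d,a)∕2`) such that for every `n`, `η` (`ηL^{n+1} = 1`), `c₀(L^{n+1})^d = c₁`, `m`, background `U` of E162's per-level data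
valued in an averaging-closed `S ≤ U1`, `0 ≤ α ≤ α₀`, mutually adjoint transporters, `‖U(b) − 1‖ ≤ αη` and `‖U(∂p) − 1‖ ≤ αη²`:
`γ′·(‖D(1)x‖² + ‖D*(1)x‖² + ‖x‖²) ≤ re⟨x, (D*D + DR_k(U)D* + aQ_k(U)†Q_k(U))x⟩` — the owner's `exists_strong_coercive_tower_diagonal_closed` at `r = 1∕L` with the
level-profile window SUPPLIED by `exists_profile_of_windows_eta`. [cite: Balaban1985BackgroundPropagators, Thm 3.11 p.416, (3.35)–(3.37) p.396, (3.16) p.393, (3.25) p.394; Balaban1985Averaging, Prop. 2 (52)–(54) p.26] -/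
theorem exists_strong_coercive_tower_diagonal_twoWindows :
    ∃ α₀ γ' : ℝ, 0 < α₀ ∧ 0 < γ' ∧ ∀ (n : ℕ) (η : ℝ), η * (L : ℝ) ^ (n + 1) = 1 →
      ∀ (c₀ c₁ : ℝ) [Fact (0 < c₀)] [Fact (0 < c₁)], c₀ * ((L : ℝ) ^ (n + 1)) ^ d = c₁ →
      ∀ (m : Fin d → ℕ) [∀ i, NeZero (m i)] (U : Bond d (towerP L m (n + 1)) → 𝔸ˣ) (αU : ℕ → ℝ) (hα1 : ∀ j, αU j ≤ 1 / 64)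
        (hU1 : ∀ (j : ℕ) (x : B7Prop1Explicit.Site d) (κ : Fin d), perCfg (towerP L m (j + 1)) (UlevOf L m (n + 1) U j) x κ ∈ U1 𝔸)
        (hreg : ∀ (j : ℕ) (y : TSite d (towerP L m j)) (κ : Fin d) (r : Fin d → Fin L),
          ‖((Wcx L (perCfg (towerP L m (j + 1)) (UlevOf L m (n + 1) U j)) (cornerSite L y) κ (boxVec L r) : 𝔸ˣ) : 𝔸) - 1‖ ≤ αU j)
        {S : Subgroup 𝔸ˣ}, AvgClosed d L S → (∀ b, U b ∈ S) →
      ∀ {α : ℝ}, 0 ≤ α → α ≤ α₀ →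
        (∀ (b : Bond d (towerP L m (n + 1))) (v u : W), ⟪adTransportW φ U b v, u⟫_ℂ = ⟪v, adTransportW φ (fun b => (U b)⁻¹) b u⟫_ℂ) →
        (∀ b, ‖(U b : 𝔸) - 1‖ ≤ α * η) →
        (∀ p : B9SectCLatticeCarrier.Plaq d (towerP L m (n + 1)), ‖(plaqHolU U p : 𝔸) - 1‖ ≤ α * η ^ 2) →
        ∀ x : BondL2K ℂ d (towerP L m (n + 1)) c₀ W,
          γ' * (‖covCurlL2K ℂ c₀ ((η : ℂ))⁻¹ (adTransportW φ (fun _ : Bond d (towerP L m (n + 1)) => (1 : 𝔸ˣ))) x‖ ^ 2 +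
              ‖covDivL2K ℂ c₀ ((η : ℂ))⁻¹ (adTransportW φ fun _ : Bond d (towerP L m (n + 1)) => (1 : 𝔸ˣ)⁻¹) x‖ ^ 2 + ‖x‖ ^ 2) ≤
            RCLike.re ⟪x, laplaceALatticeK ((η : ℂ))⁻¹ (adTransportW φ U) (adTransportW φ fun b => (U b)⁻¹) (principalOpK φ η U)
              (RofUk L m n φ η U) (QkW L m n φ U hL αU hα1 hU1 hreg (c₁ := c₁)) a x⟫_ℂ := by
  have hL0 : (0 : ℝ) < L := by exact_mod_cast lt_of_lt_of_le (by norm_num) hL2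
  have hr0 : (0 : ℝ) ≤ 1 / (L : ℝ) := by positivity
  have hr1 : 1 / (L : ℝ) < 1 := by rw [div_lt_one hL0]; exact_mod_cast lt_of_lt_of_le (by norm_num) hL2
  obtain ⟨α₁, γ', hα₁, hγ', H⟩ := exists_strong_coercive_tower_diagonal_closed L hL φ hMφ hMφ' hφ hφ' ha hr0 hr1
  obtain ⟨T, hT0, hTCw, hT3, hT2⟩ := thresholds L hL2 (d := d) hα₁
  refine ⟨T, γ', hT0, hγ', ?_⟩
  intro n η hηL c₀ c₁ _ _ hw m _ U αU hα1 hU1 hreg S hS hU α hα0 hαle hRS hUη hpl x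
  obtain ⟨hUb, hUη', εU, hεU, hUε, hεg⟩ := windows_feed L hL2 m n hS hU hT0 hTCw hT3 hT2 hηL hα0 hαle hUη hpl
  exact H n η hηL c₀ c₁ hw m U αU hα1 hU1 hreg εU hεU hUε hα₁.le le_rfl hRS hUb hUη' hεg x

end Principal

/-! ## §3 The full operator with curvature: coercive, `‖G_k‖ ≤ γ₁⁻¹`, positive definite (INTENT-9 re-issued) -/

section Curvature

variable [StarRing 𝔸] [NormedStarGroup 𝔸] [StarModule ℂ 𝔸]
  {W : Type*} [NormedAddCommGroup W] [InnerProductSpace ℂ W] [FiniteDimensional ℂ W] (φ : W ≃ₗ[ℂ] 𝔸)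
  {Mφ Mφ' : ℝ} (hMφ : 0 ≤ Mφ) (hMφ' : 0 ≤ Mφ') (hφ : ∀ w, ‖φ w‖ ≤ Mφ * ‖w‖) (hφ' : ∀ X, ‖φ.symm X‖ ≤ Mφ' * ‖X‖) {a : ℝ} (ha : 0 < a)
  (τ : 𝔸 →ₗ[ℂ] ℂ) {Cτ : ℝ} (hτ : ∀ X, ‖τ X‖ ≤ Cτ * ‖X‖) (hCτ : 0 ≤ Cτ) {ρw : ℝ} (hρw : 0 ≤ ρw)

include hL2 hMφ hMφ' hφ hφ' ha hτ hCτ hρw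

/-- **THE `k`-TH-STEP OPERATOR WITH CURVATURE IS COERCIVE ON THE DIAGONAL, FROM THE TWO WINDOWS**: `∃ α₀ γ₁ > 0` (closed in `(d, a, L, M_φ, M_φ′, C_τ, ρ_w)`;
`γ₁ = γ(d,a)∕4`) before every binder; then `γ₁‖x‖² ≤ re⟨x, Δ^{(n+1)}_a(U)x⟩` — the owner's `exists_coercive_laplaceAk_diagonal_closed` at `r = 1∕L`, the
level-profile window supplied. [cite: Balaban1985BackgroundPropagators, Thm 3.11 p.416, (3.26) p.395, (3.35)–(3.37) p.396, (3.16) p.393; Balaban1985Averaging, Prop. 2 (52)–(54) p.26] -/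
theorem exists_coercive_laplaceAk_diagonal_twoWindows :
    ∃ α₀ γ₁ : ℝ, 0 < α₀ ∧ 0 < γ₁ ∧ ∀ (n : ℕ) (η : ℝ), η * (L : ℝ) ^ (n + 1) = 1 →
      ∀ (c₀ c₁ : ℝ) [Fact (0 < c₀)] [Fact (0 < c₁)], c₀ * ((L : ℝ) ^ (n + 1)) ^ d = c₁ → |η| ^ d / c₀ ≤ ρw →
      ∀ (m : Fin d → ℕ) [∀ i, NeZero (m i)] (U : Bond d (towerP L m (n + 1)) → 𝔸ˣ) (αU : ℕ → ℝ) (hα1 : ∀ j, αU j ≤ 1 / 64)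
        (hU1 : ∀ (j : ℕ) (x : B7Prop1Explicit.Site d) (κ : Fin d), perCfg (towerP L m (j + 1)) (UlevOf L m (n + 1) U j) x κ ∈ U1 𝔸)
        (hreg : ∀ (j : ℕ) (y : TSite d (towerP L m j)) (κ : Fin d) (r : Fin d → Fin L),
          ‖((Wcx L (perCfg (towerP L m (j + 1)) (UlevOf L m (n + 1) U j)) (cornerSite L y) κ (boxVec L r) : 𝔸ˣ) : 𝔸) - 1‖ ≤ αU j)
        {S : Subgroup 𝔸ˣ}, AvgClosed d L S → (∀ b, U b ∈ S) →
      ∀ {α : ℝ}, 0 ≤ α → α ≤ α₀ →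
        (∀ (b : Bond d (towerP L m (n + 1))) (v u : W), ⟪adTransportW φ U b v, u⟫_ℂ = ⟪v, adTransportW φ (fun b => (U b)⁻¹) b u⟫_ℂ) →
        (∀ b, ‖(U b : 𝔸) - 1‖ ≤ α * η) →
        (∀ p : B9SectCLatticeCarrier.Plaq d (towerP L m (n + 1)), ‖(plaqHolU U p : 𝔸) - 1‖ ≤ α * η ^ 2) →
        ∀ x : BondL2K ℂ d (towerP L m (n + 1)) c₀ W,
          γ₁ * ‖x‖ ^ 2 ≤ RCLike.re ⟪x, laplaceAk L m n φ η U hL αU hα1 hU1 hreg τ (c₀ := c₀) (c₁ := c₁) a x⟫_ℂ := by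
  have hL0 : (0 : ℝ) < L := by exact_mod_cast lt_of_lt_of_le (by norm_num) hL2
  have hr0 : (0 : ℝ) ≤ 1 / (L : ℝ) := by positivity
  have hr1 : 1 / (L : ℝ) < 1 := by rw [div_lt_one hL0]; exact_mod_cast lt_of_lt_of_le (by norm_num) hL2
  obtain ⟨α₁, γ₁, hα₁, hγ₁, H⟩ := exists_coercive_laplaceAk_diagonal_closed L hL φ hMφ hMφ' hφ hφ' ha hr0 hr1 τ hτ hCτ hρw
  obtain ⟨T, hT0, hTCw, hT3, hT2⟩ := thresholds L hL2 (d := d) hα₁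
  refine ⟨T, γ₁, hT0, hγ₁, ?_⟩
  intro n η hηL c₀ c₁ _ _ hw hρ m _ U αU hα1 hU1 hreg S hS hU α hα0 hαle hRS hUη hpl x
  obtain ⟨hUb, hUη', εU, hεU, hUε, hεg⟩ := windows_feed L hL2 m n hS hU hT0 hTCw hT3 hT2 hηL hα0 hαle hUη hpl
  have hα₁' : α ≤ α₁ := by
    have hd : (0 : ℝ) ≤ 512 * (d + 1) * (d + 4) := by positivity
    nlinarith
  have hpl' : ∀ p : B9SectCLatticeCarrier.Plaq d (towerP L m (n + 1)), ‖(plaqHolU U p : 𝔸) - 1‖ ≤ α₁ * η ^ 2 :=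
    fun p => (hpl p).trans (mul_le_mul_of_nonneg_right hα₁' (by positivity))
  exact H n η hηL c₀ c₁ hw hρ m U αU hα1 hU1 hreg εU hεU hUε hα₁.le le_rfl hRS hUb hUη' hpl' hεg x

/-- **`‖G_k(U)y‖ ≤ γ₁⁻¹‖y‖` ON THE DIAGONAL FROM THE TWO WINDOWS** — [B9] Thm 3.4's `L²` clause for `G(U) = (Δ^{(k)}_a(U))⁻¹` (`G1LatticeK`, ANY positivity
witness), level-free constant; the owner's `exists_norm_G1k_le_diagonal_closed` at `r = 1∕L`, the level-profile window supplied.  No decay statement.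
[cite: Balaban1985BackgroundPropagators, Thm 3.4 p.400, Thm 3.11 p.416, (3.35)–(3.37) p.396; Balaban1985Averaging, Prop. 2 (52)–(54) p.26] -/
theorem exists_norm_G1k_le_diagonal_twoWindows :
    ∃ α₀ γ₁ : ℝ, 0 < α₀ ∧ 0 < γ₁ ∧ ∀ (n : ℕ) (η : ℝ), η * (L : ℝ) ^ (n + 1) = 1 →
      ∀ (c₀ c₁ : ℝ) [Fact (0 < c₀)] [Fact (0 < c₁)], c₀ * ((L : ℝ) ^ (n + 1)) ^ d = c₁ → |η| ^ d / c₀ ≤ ρw →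
      ∀ (m : Fin d → ℕ) [∀ i, NeZero (m i)] (U : Bond d (towerP L m (n + 1)) → 𝔸ˣ) (αU : ℕ → ℝ) (hα1 : ∀ j, αU j ≤ 1 / 64)
        (hU1 : ∀ (j : ℕ) (x : B7Prop1Explicit.Site d) (κ : Fin d), perCfg (towerP L m (j + 1)) (UlevOf L m (n + 1) U j) x κ ∈ U1 𝔸)
        (hreg : ∀ (j : ℕ) (y : TSite d (towerP L m j)) (κ : Fin d) (r : Fin d → Fin L),
          ‖((Wcx L (perCfg (towerP L m (j + 1)) (UlevOf L m (n + 1) U j)) (cornerSite L y) κ (boxVec L r) : 𝔸ˣ) : 𝔸) - 1‖ ≤ αU j)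
        {S : Subgroup 𝔸ˣ}, AvgClosed d L S → (∀ b, U b ∈ S) →
      ∀ {α : ℝ}, 0 ≤ α → α ≤ α₀ →
        (∀ (b : Bond d (towerP L m (n + 1))) (v u : W), ⟪adTransportW φ U b v, u⟫_ℂ = ⟪v, adTransportW φ (fun b => (U b)⁻¹) b u⟫_ℂ) →
        (∀ b, ‖(U b : 𝔸) - 1‖ ≤ α * η) →
        (∀ p : B9SectCLatticeCarrier.Plaq d (towerP L m (n + 1)), ‖(plaqHolU U p : 𝔸) - 1‖ ≤ α * η ^ 2) →
        ∀ (hpos : ∀ x : BondL2K ℂ d (towerP L m (n + 1)) c₀ W, x ≠ 0 →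
            0 < RCLike.re ⟪x, laplaceAk L m n φ η U hL αU hα1 hU1 hreg τ (c₀ := c₀) (c₁ := c₁) a x⟫_ℂ)
          (y : BondL2K ℂ d (towerP L m (n + 1)) c₀ W), ‖G1LatticeK hpos y‖ ≤ γ₁⁻¹ * ‖y‖ := by
  have hL0 : (0 : ℝ) < L := by exact_mod_cast lt_of_lt_of_le (by norm_num) hL2
  have hr0 : (0 : ℝ) ≤ 1 / (L : ℝ) := by positivity
  have hr1 : 1 / (L : ℝ) < 1 := by rw [div_lt_one hL0]; exact_mod_cast lt_of_lt_of_le (by norm_num) hL2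
  obtain ⟨α₁, γ₁, hα₁, hγ₁, H⟩ := exists_norm_G1k_le_diagonal_closed L hL φ hMφ hMφ' hφ hφ' ha hr0 hr1 τ hτ hCτ hρw
  obtain ⟨T, hT0, hTCw, hT3, hT2⟩ := thresholds L hL2 (d := d) hα₁
  refine ⟨T, γ₁, hT0, hγ₁, ?_⟩
  intro n η hηL c₀ c₁ _ _ hw hρ m _ U αU hα1 hU1 hreg S hS hU α hα0 hαle hRS hUη hpl hpos y
  obtain ⟨hUb, hUη', εU, hεU, hUε, hεg⟩ := windows_feed L hL2 m n hS hU hT0 hTCw hT3 hT2 hηL hα0 hαle hUη hpl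
  have hα₁' : α ≤ α₁ := by
    have hd : (0 : ℝ) ≤ 512 * (d + 1) * (d + 4) := by positivity
    nlinarith
  have hpl' : ∀ p : B9SectCLatticeCarrier.Plaq d (towerP L m (n + 1)), ‖(plaqHolU U p : 𝔸) - 1‖ ≤ α₁ * η ^ 2 :=
    fun p => (hpl p).trans (mul_le_mul_of_nonneg_right hα₁' (by positivity))
  exact H n η hηL c₀ c₁ hw hρ m U αU hα1 hU1 hreg εU hεU hUε hα₁.le le_rfl hRS hUb hUη' hpl' hεg hpos y

/-- **[B9] THM 3.11 «Δ_a IS POSITIVE DEFINITE» FOR PRINT's `k`-TH-STEP OPERATOR WITH CURVATURE, ON THE DIAGONAL, FROM THE TWO WINDOWS**: `∃ α₀ > 0`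
before every binder; then `0 < re⟨x, Δ^{(n+1)}_a(U)x⟩` for `x ≠ 0` — the owner's `exists_laplaceAk_pos_diagonal_closed` at `r = 1∕L`, the level-profile
window supplied; the displayed `hpos` of `B9Eq326OperatorTower.G1k ∕ H1k ∕ frakGk` DISCHARGED from the two windows of (3.35).
[cite: Balaban1985BackgroundPropagators, Thm 3.11 p.416, (3.26) p.395, (3.35)–(3.37) p.396, (3.16) p.393; Balaban1985Averaging, Prop. 2 (52)–(54) p.26] -/
theorem exists_laplaceAk_pos_diagonal_twoWindows :
    ∃ α₀ : ℝ, 0 < α₀ ∧ ∀ (n : ℕ) (η : ℝ), η * (L : ℝ) ^ (n + 1) = 1 →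
      ∀ (c₀ c₁ : ℝ) [Fact (0 < c₀)] [Fact (0 < c₁)], c₀ * ((L : ℝ) ^ (n + 1)) ^ d = c₁ → |η| ^ d / c₀ ≤ ρw →
      ∀ (m : Fin d → ℕ) [∀ i, NeZero (m i)] (U : Bond d (towerP L m (n + 1)) → 𝔸ˣ) (αU : ℕ → ℝ) (hα1 : ∀ j, αU j ≤ 1 / 64)
        (hU1 : ∀ (j : ℕ) (x : B7Prop1Explicit.Site d) (κ : Fin d), perCfg (towerP L m (j + 1)) (UlevOf L m (n + 1) U j) x κ ∈ U1 𝔸)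
        (hreg : ∀ (j : ℕ) (y : TSite d (towerP L m j)) (κ : Fin d) (r : Fin d → Fin L),
          ‖((Wcx L (perCfg (towerP L m (j + 1)) (UlevOf L m (n + 1) U j)) (cornerSite L y) κ (boxVec L r) : 𝔸ˣ) : 𝔸) - 1‖ ≤ αU j)
        {S : Subgroup 𝔸ˣ}, AvgClosed d L S → (∀ b, U b ∈ S) →
      ∀ {α : ℝ}, 0 ≤ α → α ≤ α₀ →
        (∀ (b : Bond d (towerP L m (n + 1))) (v u : W), ⟪adTransportW φ U b v, u⟫_ℂ = ⟪v, adTransportW φ (fun b => (U b)⁻¹) b u⟫_ℂ) →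
        (∀ b, ‖(U b : 𝔸) - 1‖ ≤ α * η) →
        (∀ p : B9SectCLatticeCarrier.Plaq d (towerP L m (n + 1)), ‖(plaqHolU U p : 𝔸) - 1‖ ≤ α * η ^ 2) →
        ∀ x : BondL2K ℂ d (towerP L m (n + 1)) c₀ W, x ≠ 0 →
          0 < RCLike.re ⟪x, laplaceAk L m n φ η U hL αU hα1 hU1 hreg τ (c₀ := c₀) (c₁ := c₁) a x⟫_ℂ := by
  obtain ⟨α₀, γ₁, hα₀, hγ₁, H⟩ := exists_coercive_laplaceAk_diagonal_twoWindows L hL hL2 φ hMφ hMφ' hφ hφ' ha τ hτ hCτ hρw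
  refine ⟨α₀, hα₀, ?_⟩
  intro n η hηL c₀ c₁ _ _ hw hρ m _ U αU hα1 hU1 hreg S hS hU α hα0 hαle hRS hUη hpl x hx
  have h := H n η hηL c₀ c₁ hw hρ m U αU hα1 hU1 hreg hS hU hα0 hαle hRS hUη hpl x
  have hx2 : 0 < ‖x‖ ^ 2 := by positivity
  nlinarith

end Curvature

end Literature.MathematicalPhysics.QuantumFieldTheory.Balaban1983to89.B9Thm311SmallFieldCoercivityTowerTwoWindows

end
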